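import Summits.KontsevichZagierPeriods.KontsevichZagierPeriods.Theorems.TorsionLogsNeronTorsionFlexTorsionValue

/-!
# The Néron–torsion identity on RAW fibre integrals (route `TorsionLogs`, crux `TorsionSectorComplete`,
# stmt-KontsevichZagierPeriods-14212, line `NeronTorsionModularArc`, rung `NeronTorsionArcs`)

The registered line `Cruxes/TorsionSectorComplete/Lines/NeronTorsionModularArc.lean` integrates the
fibrewise Néron–torsion identity along a real arc `t₀ < t < t₁` of the pencil
`f_t(x) = 4x³ − t x − (4e₁³ − t e₁)`; its on-path workfile `Lines/NeronTorsionArcs_onpath.lean` reduces the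
forward discipline's F4 lemma `KontsevichZagierPeriods → NeronTorsionArcs` to ONE real-analytic value identity,
`ArcValueIdentity`.  The fibres over transcendental `t` are not `ℚ`-semialgebraic, so the landed fibrewise
theorem `TorsionLogs.NeronHeight.neronTorsion_value_identity` (stated for `KZ.IntegralRep 2` data `rI`, `rP`)
cannot be instantiated fibre by fibre.  This file restates and proves it on RAW integrals — the iterated
triangle integral `∫_{e₁}^{x_P} (∫_{e₁}^{x} x′dx′/√f(x′)) dx/√f(x)` in place of `rI.value` and the product
`(∫_{e₁}^∞ dx/√f)(∫_{e₁}^∞ (g₂x+2g₃)dx/(2x²√f))` in place of `rP.value` (exactly what `value_triangle_eq` /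
`value_quadrant_eq` turn the values into) — together with the two positivity facts the arc integration needs:
`0 < |ψ_{N−1}(x_P, y_P/2)|` (division formula `‖σ((N−1)u)‖ = |ψ_{N−1}|‖σ u‖^{(N−1)²}` and `σ ≠ 0` off the
lattice) and `0 < 3e₁² − g₂/4` (`four_mul_log_norm_weierstrassSigma_half`).  The proof is the landed one
(prover-fwd2-land-3-g8-0) read before its two `value_*_eq` rewrites; no new mathematics.
[Silverman 1994 (ATAEC) Thm VI.1.1, VI.3.2; Silverman 2009 (AEC) Ex. 6.15]

prover-fwd2-land-1-g28-0 (on-path lander, row owner of candidates row 8), 2026-08-19.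
-/

-- single-conjunct summit: Sub = Summit, so the namespace segment repeats by design (CONVENTIONS §2)
set_option linter.dupNamespace false

noncomputable section

open Set MeasureTheory Filter Topology Complex Polynomial
open scoped PeriodPair Polynomial.Bivariate
open Literature.NumberTheory.Transcendental
open Summit.KontsevichZagierPeriods.KontsevichZagierPeriods.Cruxes.NeronTorsionSector.Translation
  (weierstrassPRe_half_eq integral_Ioi_weierstrassPRe_eq)
open Summit.KontsevichZagierPeriods.KontsevichZagierPeriods.TorsionLogs.NeronDuplication
open Summit.KontsevichZagierPeriods.KontsevichZagierPeriods.TorsionLogs.NeronHeight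

namespace Summit.KontsevichZagierPeriods.KontsevichZagierPeriods.TorsionLogs.NeronArcs

variable {L : PeriodPair}

/-- **Non-vanishing of the division value at a real point with a rational period**: if `t ∈ (0, Ω₀)`
is real with `(n+1)t = bΩ₀` (`b ∈ ℕ`), then `|ψₙ(X t, Y t/2)| > 0` — from the division formula
`‖σ(nt)‖ = |ψₙ(X t, Y t/2)|·‖σ t‖^{n²}` (`norm_weierstrassSigma_nat_mul_real`) with `nt = bΩ₀ − t` off the
lattice, where `σ` does not vanish. [cite: SilvermanAEC2009, Exercise 6.15] -/
theorem abs_evalEval_ψ_pos_of_period (hR : L.IsReal) {t : ℝ} (ht : t ∈ Ioo 0 L.minRealPeriod)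
    (n b : ℕ) (hb : ((n : ℝ) + 1) * t = b * L.minRealPeriod) :
    0 < |((⟨0, 0, 0, -L.g₂.re / 4, -L.g₃.re / 4⟩ : WeierstrassCurve ℝ).ψ n).evalEval
        (L.weierstrassPRe t) (L.derivWeierstrassPRe t / 2)| := by
  have ht' : (t : ℂ) ∉ L.lattice := hR.ofReal_notMem_lattice ht.1 ht.2
  have hσt : ‖L.weierstrassSigma t‖ ≠ 0 := norm_ne_zero_iff.mpr (L.weierstrassSigma_ne_zero ht')
  have h1 := norm_weierstrassSigma_nat_mul_real hR n t
  rw [show ((n * t : ℝ) : ℂ) = ((b * L.minRealPeriod - t : ℝ) : ℂ) by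
      rw [show (n : ℝ) * t = b * L.minRealPeriod - t by linarith [hb]],
    norm_weierstrassSigma_nat_mul_sub hR b t] at h1
  refine (abs_nonneg _).lt_of_ne' ?_
  intro h0
  rw [h0, zero_mul] at h1
  exact mul_ne_zero (Real.exp_pos _).ne' hσt h1

/-- **The Néron–torsion identity on raw fibre integrals.**  For the real curve
`y² = f(x) = 4x³ − g₂x − g₃` (`Δ ≠ 0`, largest root `e₁ > 0`), a point `(x_P, y_P)` with `x_P > e₁` and
`N·∫_{x_P}^∞ dx/√f = a·(2∫_{e₁}^∞ dx/√f)` (`N ≥ 3`):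
`0 < |ψ_{N−1}(x_P, y_P/2)|`, `0 < 3e₁² − g₂/4`, and
`(N−2)·(4N²·∫_{e₁}^{x_P}(∫_{e₁}^{x} x′/√f(x′) dx′)(√f(x))⁻¹dx + (N−2a)²·(∫_{e₁}^∞(√f)⁻¹)(∫_{e₁}^∞(g₂x+2g₃)/(2x²√f)))
   = 4N·log|ψ_{N−1}(x_P, y_P/2)| − N²(N−2)·log(3e₁² − g₂/4)`
— `TorsionLogs.NeronHeight.neronTorsion_value_identity` before its `value_triangle_eq` /
`value_quadrant_eq` rewrites (the archimedean Néron height of a real `N`-torsion point, `λ([N−1]P) = λ(P)`).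
[cite: Silverman1994, Thm VI.1.1, Thm VI.3.2] -/
theorem neronTorsion_raw_identity :
    ∀ (g₂ g₃ e₁ xP yP : ℝ) (N a : ℕ) (f : ℝ → ℝ), (∀ x, f x = 4 * x ^ 3 - g₂ * x - g₃) →
    g₂ ^ 3 - 27 * g₃ ^ 2 ≠ 0 → f e₁ = 0 → 0 < e₁ → (∀ x, e₁ < x → 0 < f x) → e₁ < xP →
    yP ^ 2 = f xP → 3 ≤ N →
    (N : ℝ) * (∫ x in Set.Ioi xP, (Real.sqrt (f x))⁻¹) =
      a * (2 * ∫ x in Set.Ioi e₁, (Real.sqrt (f x))⁻¹) →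
    0 < |((⟨0, 0, 0, -g₂ / 4, -g₃ / 4⟩ : WeierstrassCurve ℝ).ψ ((N : ℤ) - 1)).evalEval xP (yP / 2)| ∧
    0 < 3 * e₁ ^ 2 - g₂ / 4 ∧
    ((N : ℝ) - 2) * (4 * (N : ℝ) ^ 2 *
          (∫ x in Set.Ioo e₁ xP, (∫ y in Set.Ioo e₁ x, y / Real.sqrt (f y)) * (Real.sqrt (f x))⁻¹) +
        ((N : ℝ) - 2 * a) ^ 2 *
          ((∫ x in Set.Ioi e₁, (Real.sqrt (f x))⁻¹) *
            (∫ x in Set.Ioi e₁, (g₂ * x + 2 * g₃) / (2 * x ^ 2 * Real.sqrt (f x))))) =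
      4 * (N : ℝ) * Real.log
          |((⟨0, 0, 0, -g₂ / 4, -g₃ / 4⟩ : WeierstrassCurve ℝ).ψ ((N : ℤ) - 1)).evalEval xP (yP / 2)|
        - (N : ℝ) ^ 2 * ((N : ℝ) - 2) * Real.log (3 * e₁ ^ 2 - g₂ / 4) := by
  intro g₂ g₃ e₁ xP yP N a f hf hΔ hfe he₁ hpos hxP hyP hN hper
  -- the real lattice with invariants `g₂, g₃`
  obtain ⟨L, hL2, hL3⟩ :=
    PeriodPair.uniformization_holds (g₂ : ℂ) (g₃ : ℂ) (by exact_mod_cast hΔ)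
  have hR : L.IsReal := PeriodPair.isReal_of_g₂_g₃_real PeriodPair.uniformization_unique_holds
    (by rw [hL2]; exact Complex.ofReal_im g₂) (by rw [hL3]; exact Complex.ofReal_im g₃)
  have hg2 : L.g₂.re = g₂ := by rw [hL2, Complex.ofReal_re]
  have hg3 : L.g₃.re = g₃ := by rw [hL3, Complex.ofReal_re]
  have hfun : f = fun x => 4 * x ^ 3 - g₂ * x - g₃ := funext hf
  subst hfun hg2 hg3
  simp only at hfe hpos hyP hper ⊢
  set T := L.minRealPeriod / 2 with hT
  have hΩ := hR.minRealPeriod_pos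
  have hT0 : 0 < T := by positivity
  have hXT : L.weierstrassPRe T = e₁ := weierstrassPRe_half_eq hR hfe hpos
  -- the parameter `u = u_P ∈ (0, T)` of `P`
  have hxP' : xP ∈ Ioi (L.weierstrassPRe (L.minRealPeriod / 2)) := by rw [← hT, hXT]; exact hxP
  rw [← hR.image_weierstrassPRe_Ioo] at hxP'
  obtain ⟨u, hu, hXu⟩ := hxP'
  have hu' : u ∈ Ioo 0 L.minRealPeriod := ⟨hu.1, by linarith [hu.2]⟩
  have hun : (u : ℂ) ∉ L.lattice := hR.ofReal_notMem_lattice hu'.1 hu'.2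
  have hY2 : L.derivWeierstrassPRe u ^ 2 = 4 * xP ^ 3 - L.g₂.re * xP - L.g₃.re := by
    rw [← hXu]; exact hR.derivWeierstrassPRe_sq hun
  -- the two raw values
  have hI : ∫ x in Ioo e₁ xP, (∫ y in Ioo e₁ x, y / Real.sqrt (4 * y ^ 3 - L.g₂.re * y - L.g₃.re)) *
        (Real.sqrt (4 * x ^ 3 - L.g₂.re * x - L.g₃.re))⁻¹ =
      Real.log ‖L.weierstrassSigma ((L.minRealPeriod / 2 : ℝ) : ℂ)‖ -
      Real.log ‖L.weierstrassSigma u‖ -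
      (L.weierstrassZeta ((L.minRealPeriod / 2 : ℝ) : ℂ)).re * (L.minRealPeriod / 2 - u) := by
    rw [← iterated_integral_weierstrassPRe hR (by rw [← hT]; exact hu), ← hT, hXT, hXu]
  have hE : ∫ x in Ioi e₁, (L.g₂.re * x + 2 * L.g₃.re) /
      (2 * x ^ 2 * Real.sqrt (4 * x ^ 3 - L.g₂.re * x - L.g₃.re)) =
      2 * (L.weierstrassZeta ((L.minRealPeriod / 2 : ℝ) : ℂ)).re := by
    rw [← integral_quasiPeriodDensity_eq hR (by rw [← hT, hXT]; exact he₁), ← hT, hXT]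
  have hω1 : ∫ x in Ioi xP, (Real.sqrt (4 * x ^ 3 - L.g₂.re * x - L.g₃.re))⁻¹ = u := by
    rw [← hXu]; exact integral_Ioi_weierstrassPRe_eq hR ⟨hu.1, hu.2.le⟩
  have hω2 : ∫ x in Ioi e₁, (Real.sqrt (4 * x ^ 3 - L.g₂.re * x - L.g₃.re))⁻¹ = T := by
    rw [← hXT, hT]; exact hR.integral_Ioi_inv_sqrt_cubic_eq
  -- the period relation `N u = a Ω₀`
  rw [hω1, hω2] at hper
  -- the constant at the 2-torsion point (with `D > 0`) and the real quasi-period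
  obtain ⟨hDpos, hconst⟩ := four_mul_log_norm_weierstrassSigma_half hR
  rw [← hT, hXT] at hconst hDpos
  have hηre : (L.quasiPeriodMap L.minRealPeriod).re =
      2 * (L.weierstrassZeta ((L.minRealPeriod / 2 : ℝ) : ℂ)).re := by
    rw [quasiPeriodMap_minRealPeriod hR]
    simp [Complex.mul_re]
  rw [hηre] at hconst
  -- the division value at `u`
  have hN1 : ((N - 1 : ℕ) : ℝ) = (N : ℝ) - 1 := by
    rw [Nat.cast_sub (by omega), Nat.cast_one]
  have hb : (((N - 1 : ℕ) : ℝ) + 1) * u = a * L.minRealPeriod := by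
    rw [hN1, hT] at *; linarith [hper]
  have hcore := log_abs_evalEval_ψ_of_period hR hu' (N - 1) a hb
  have hne := abs_evalEval_ψ_pos_of_period hR hu' (N - 1) a hb
  have hidx : ((N - 1 : ℕ) : ℤ) = (N : ℤ) - 1 := by omega
  -- the sign of `y_P` is immaterial
  have hsq : yP ^ 2 = L.derivWeierstrassPRe u ^ 2 := by rw [hY2]; exact hyP
  have hψpos : 0 < |((⟨0, 0, 0, -L.g₂.re / 4, -L.g₃.re / 4⟩ : WeierstrassCurve ℝ).ψ
        ((N : ℤ) - 1)).evalEval xP (yP / 2)| := by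
    rcases sq_eq_sq_iff_eq_or_eq_neg.1 hsq with hy | hy
    · rw [← hXu, ← hidx, hy]; exact hne
    · rw [← hXu, ← hidx, hy, neg_div, ← neg_div, abs_evalEval_ψ_neg hR hu' (N - 1)]; exact hne
  have hcore' : Real.log |((⟨0, 0, 0, -L.g₂.re / 4, -L.g₃.re / 4⟩ : WeierstrassCurve ℝ).ψ
        ((N : ℤ) - 1)).evalEval xP (yP / 2)| =
      a * (L.quasiPeriodMap L.minRealPeriod).re * (a * (L.minRealPeriod / 2) - u) -
        (((N - 1 : ℕ) : ℝ) ^ 2 - 1) * Real.log ‖L.weierstrassSigma u‖ := by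
    rcases sq_eq_sq_iff_eq_or_eq_neg.1 hsq with hy | hy
    · rw [← hcore, hXu, hidx, hy]
    · rw [← hcore, ← abs_evalEval_ψ_neg hR hu' (N - 1), hXu, hidx, hy]
  rw [hηre, hN1] at hcore'
  refine ⟨hψpos, hDpos, ?_⟩
  rw [hI, hω2, hE, hcore']
  rw [hT] at *
  linear_combination ((N : ℝ) ^ 2 * ((N : ℝ) - 2)) * hconst +
    (4 * (L.weierstrassZeta ((L.minRealPeriod / 2 : ℝ) : ℂ)).re * ((N : ℝ) * ((N : ℝ) - 2) + 2 * a)) * hper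

end Summit.KontsevichZagierPeriods.KontsevichZagierPeriods.TorsionLogs.NeronArcs

end
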